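import Mathlib
import Literature.Combinatorics.Additive.TripleProductProperty

/-!
# `SingleAutomatonRigidity`, stub `stub_blockCover`: the block cover count

Stub `stub_blockCover` of line `Sketch`, crux `stmt-MatrixMultiplication-7359`
(`Summit.MatrixMultiplication.MatrixMultiplication.Theses.AutomaticSTPPDesigns.SingleAutomatonRigidity`),
route `MatrixMultiplication/AutomaticSTPPDesigns`.

For one triple `(A, B, C)` of finite subsets of an additive abelian group with the (additive) triple
product property, and three sets of removed differences `R_D, R_E, R_F` hitting every block triple
(`a - b ∈ R_D ∨ b - c ∈ R_E ∨ c - a ∈ R_F` for all `(a, b, c) ∈ A × B × C`):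
`|A||B||C| ≤ |R_D ∩ (A - B)|·|C| + |R_E ∩ (B - C)|·|A| + |R_F ∩ (C - A)|·|B|`.

Proof: `A ×ˢ B ×ˢ C ⊆ S_D ∪ S_E ∪ S_F` with `S_D = {(a, b, c) : a - b ∈ R_D}` etc.; the map
`(a, b, c) ↦ (a - b, c)` is injective on `A ×ˢ B ×ˢ C` by the triple product property (which
unfolds to `a + -a' + (b + -b') + (c + -c') = 0 → a = a' ∧ b = b' ∧ c = c'`; taken with
`u = u' = c`) and sends `S_D` into `(R_D ∩ (A - B)) ×ˢ C`, so `|S_D| ≤ |R_D ∩ (A - B)|·|C|`;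
symmetrically `|S_E| ≤ |R_E ∩ (B - C)|·|A|` via `(a, b, c) ↦ (b - c, a)` and
`|S_F| ≤ |R_F ∩ (C - A)|·|B|` via `(a, b, c) ↦ (c - a, b)`.
-/

set_option linter.dupNamespace false

namespace Summit.MatrixMultiplication.MatrixMultiplication.Theorems.SingleAutomatonRigidity

open Finset
open Literature.Combinatorics.Additive

/-- **Block cover count**: for one triple with the triple product property, if every
`(a, b, c) ∈ A × B × C` has `a - b ∈ R_D` or `b - c ∈ R_E` or `c - a ∈ R_F`, then
`|A||B||C| ≤ |R_D ∩ (A - B)|·|C| + |R_E ∩ (B - C)|·|A| + |R_F ∩ (C - A)|·|B|`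
(TPP makes `(a, b) ↦ a - b` injective on `A × B`, etc.). -/
theorem stub_blockCover {H : Type*} [AddCommGroup H] [DecidableEq H] (A B C : Finset H)
    (hT : AddTripleProductProperty A B C) (RD RE RF : Finset H)
    (hhit : ∀ a ∈ A, ∀ b ∈ B, ∀ c ∈ C, a - b ∈ RD ∨ b - c ∈ RE ∨ c - a ∈ RF) :
    A.card * B.card * C.card ≤
      (RD ∩ image₂ (· - ·) A B).card * C.card + (RE ∩ image₂ (· - ·) B C).card * A.card +
        (RF ∩ image₂ (· - ·) C A).card * B.card := by
  -- the three covering pieces of the block `A ×ˢ B ×ˢ C`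
  have hcover : A ×ˢ B ×ˢ C ⊆
      ((A ×ˢ B ×ˢ C).filter fun x : H × H × H => x.1 - x.2.1 ∈ RD) ∪
        ((A ×ˢ B ×ˢ C).filter fun x : H × H × H => x.2.1 - x.2.2 ∈ RE) ∪
          ((A ×ˢ B ×ˢ C).filter fun x : H × H × H => x.2.2 - x.1 ∈ RF) := by
    rintro ⟨a, b, c⟩ hx
    have hx' := hx
    simp only [mem_product] at hx'
    rcases hhit a hx'.1 b hx'.2.1 c hx'.2.2 with h | h | h
    · exact mem_union_left _ (mem_union_left _ (mem_filter.2 ⟨hx, h⟩))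
    · exact mem_union_left _ (mem_union_right _ (mem_filter.2 ⟨hx, h⟩))
    · exact mem_union_right _ (mem_filter.2 ⟨hx, h⟩)
  -- `S_D`: `(a, b, c) ↦ (a - b, c)` is injective with image in `(R_D ∩ (A - B)) ×ˢ C`
  have hD : ((A ×ˢ B ×ˢ C).filter fun x : H × H × H => x.1 - x.2.1 ∈ RD).card ≤
      (RD ∩ image₂ (· - ·) A B).card * C.card := by
    rw [← card_product]
    refine card_le_card_of_injOn (fun x : H × H × H => (x.1 - x.2.1, x.2.2)) ?_ ?_
    · rintro ⟨a, b, c⟩ hx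
      simp only [mem_coe, mem_filter, mem_product] at hx
      simp only [mem_coe, mem_product, mem_inter]
      exact ⟨⟨hx.2, mem_image₂_of_mem hx.1.1 hx.1.2.1⟩, hx.1.2.2⟩
    · rintro ⟨a, b, c⟩ hx ⟨a', b', c'⟩ hy hxy
      simp only [mem_coe, mem_filter, mem_product] at hx hy
      simp only [Prod.mk.injEq] at hxy
      obtain ⟨h1, rfl⟩ := hxy
      have key : a + -a' + (b' + -b) + (c + -c) = 0 := by
        have e : a + -a' + (b' + -b) + (c + -c) = (a - b) - (a' - b') := by abel
        rw [e, h1, sub_self]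
      obtain ⟨rfl, h2, -⟩ :=
        hT a hx.1.1 a' hy.1.1 b' hy.1.2.1 b hx.1.2.1 c hx.1.2.2 c hx.1.2.2 key
      rw [h2]
  -- `S_E`: `(a, b, c) ↦ (b - c, a)` is injective with image in `(R_E ∩ (B - C)) ×ˢ A`
  have hE : ((A ×ˢ B ×ˢ C).filter fun x : H × H × H => x.2.1 - x.2.2 ∈ RE).card ≤
      (RE ∩ image₂ (· - ·) B C).card * A.card := by
    rw [← card_product]
    refine card_le_card_of_injOn (fun x : H × H × H => (x.2.1 - x.2.2, x.1)) ?_ ?_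
    · rintro ⟨a, b, c⟩ hx
      simp only [mem_coe, mem_filter, mem_product] at hx
      simp only [mem_coe, mem_product, mem_inter]
      exact ⟨⟨hx.2, mem_image₂_of_mem hx.1.2.1 hx.1.2.2⟩, hx.1.1⟩
    · rintro ⟨a, b, c⟩ hx ⟨a', b', c'⟩ hy hxy
      simp only [mem_coe, mem_filter, mem_product] at hx hy
      simp only [Prod.mk.injEq] at hxy
      obtain ⟨h1, rfl⟩ := hxy
      have key : a + -a + (b + -b') + (c' + -c) = 0 := by
        have e : a + -a + (b + -b') + (c' + -c) = (b - c) - (b' - c') := by abel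
        rw [e, h1, sub_self]
      obtain ⟨-, rfl, h3⟩ :=
        hT a hx.1.1 a hx.1.1 b hx.1.2.1 b' hy.1.2.1 c' hy.1.2.2 c hx.1.2.2 key
      rw [h3]
  -- `S_F`: `(a, b, c) ↦ (c - a, b)` is injective with image in `(R_F ∩ (C - A)) ×ˢ B`
  have hF : ((A ×ˢ B ×ˢ C).filter fun x : H × H × H => x.2.2 - x.1 ∈ RF).card ≤
      (RF ∩ image₂ (· - ·) C A).card * B.card := by
    rw [← card_product]
    refine card_le_card_of_injOn (fun x : H × H × H => (x.2.2 - x.1, x.2.1)) ?_ ?_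
    · rintro ⟨a, b, c⟩ hx
      simp only [mem_coe, mem_filter, mem_product] at hx
      simp only [mem_coe, mem_product, mem_inter]
      exact ⟨⟨hx.2, mem_image₂_of_mem hx.1.2.2 hx.1.1⟩, hx.1.2.1⟩
    · rintro ⟨a, b, c⟩ hx ⟨a', b', c'⟩ hy hxy
      simp only [mem_coe, mem_filter, mem_product] at hx hy
      simp only [Prod.mk.injEq] at hxy
      obtain ⟨h1, rfl⟩ := hxy
      have key : a' + -a + (b + -b) + (c + -c') = 0 := by
        have e : a' + -a + (b + -b) + (c + -c') = (c - a) - (c' - a') := by abel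
        rw [e, h1, sub_self]
      obtain ⟨h0, -, rfl⟩ :=
        hT a' hy.1.1 a hx.1.1 b hx.1.2.1 b hx.1.2.1 c hx.1.2.2 c' hy.1.2.2 key
      rw [h0]
  calc A.card * B.card * C.card = (A ×ˢ B ×ˢ C).card := by
        rw [card_product, card_product, mul_assoc]
    _ ≤ _ := card_le_card hcover
    _ ≤ _ := (card_union_le _ _).trans (Nat.add_le_add_right (card_union_le _ _) _)
    _ ≤ _ := Nat.add_le_add (Nat.add_le_add hD hE) hF

end Summit.MatrixMultiplication.MatrixMultiplication.Theorems.SingleAutomatonRigidity
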